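import Mathlib

/-!
# Sketch — first lemmas of the two crux ideas for `WilsonMobilityGap.MobilityGap`
(stmt-QuantumFields-9150), crux-ideate round 1, ideator 1.

* Card `threshold-defined-mcrit`: the abstract THRESHOLD LEMMA (the witness datum `reg.mcrit k`
  is chosen as the least bare mass above which the one-scale fractional-moment input holds at
  every volume; only continuity of each finite-volume functional and the upper anchor are used).
* Card `valence-pion-spectral-pins`: the norm equivalence `N₁ ≍ N₂` between the crux's entrywise
  ℓ¹ block norm and the valence-pion contraction, and the Källén–Lehmann log-convexity /
  extrapolation lemma that turns ONE borderline lower bound at distance `ℓ` into a physical-rate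
  lower bound at all `n ≥ ℓ`.
All statements are over Mathlib only; proofs are not the point here (sorry).
-/

namespace Summit.QuantumFields.QCD.Cruxes.MobilityGap.Sketch

open scoped BigOperators
open Set

/-- THRESHOLD LEMMA (card `threshold-defined-mcrit`). `φ i` = the normalised one-scale
fractional-moment functional of the phase-quenched quark propagator at bare offset `m`, one index
`i` per (volume `S ≥ L_k`, flavour, shell site); `hi` = the upper anchor (κ ≤ 1/8 side, where the
proved barrier theorem `HoppingExpansionLocality` makes every `φ i ≤ 1`). Conclusion: a least
admissible bare mass `m⋆ ∈ [lo, hi]` exists; by leastness, below `m⋆` the input fails at some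
volume (borderline), and on `[m⋆, hi]` it holds at every volume. [folklore] -/
theorem thresholdMass_exists {ι : Type*} (φ : ι → ℝ → ℝ) (hφ : ∀ i, Continuous (φ i))
    {lo hi : ℝ} (hlo : lo ≤ hi) (hanchor : ∀ i, φ i hi ≤ 1) :
    ∃ mstar : ℝ, IsLeast {m' ∈ Icc lo hi | ∀ i, ∀ m ∈ Icc m' hi, φ i m ≤ 1} mstar := by
  sorry

/-- Borderline property of the threshold: if the input fails somewhere in `[lo, hi]` (the LOWER
anchor: gaplessness at some bare mass, e.g. forced by the index jump of the sibling route
IntegerCriticalLine), then `lo < m⋆` and the input fails at bare masses arbitrarily close below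
`m⋆`. [folklore] -/
theorem thresholdMass_borderline {ι : Type*} (φ : ι → ℝ → ℝ) (hφ : ∀ i, Continuous (φ i))
    {lo hi mstar : ℝ} (hlo : lo ≤ hi)
    (hleast : IsLeast {m' ∈ Icc lo hi | ∀ i, ∀ m ∈ Icc m' hi, φ i m ≤ 1} mstar)
    (hlow : ∃ i, ∃ m ∈ Icc lo hi, 1 < φ i m) :
    lo < mstar ∧ ∀ ε > 0, ∃ m ∈ Icc lo hi, mstar - ε < m ∧ m < mstar ∧ ∃ i, 1 < φ i m := by
  sorry

/-- Norm equivalence, lower half (card `valence-pion-spectral-pins`): the entrywise ℓ¹ norm of a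
block (the crux's `∑ a i b j ‖G_{ai,bj}‖`) dominates the Frobenius norm, whose square is the
valence-pion contraction `tr G G†` configuration-wise. [folklore] -/
theorem sumSq_le_l1_sq {n : ℕ} (x : Fin n → ℂ) :
    ∑ i, ‖x i‖ ^ 2 ≤ (∑ i, ‖x i‖) ^ 2 := by
  sorry

/-- Norm equivalence, upper half (Cauchy–Schwarz; `n = 144` for a colour–spin block). [folklore] -/
theorem l1_sq_le_card_mul_sumSq {n : ℕ} (x : Fin n → ℂ) :
    (∑ i, ‖x i‖) ^ 2 ≤ n * ∑ i, ‖x i‖ ^ 2 := by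
  sorry

/-- Källén–Lehmann log-convexity: a two-point function with a positive spectral representation
`C t = ∑ w_i e^{-E_i t}` (reflection positivity ⇒ positive transfer matrix) is log-convex in the
time separation, i.e. the effective mass `log (C t / C (t+1))` is non-increasing. [folklore] -/
theorem specSum_logConvex {N : ℕ} (w E : Fin N → ℝ) (hw : ∀ i, 0 ≤ w i) (t : ℕ) :
    (∑ i, w i * Real.exp (-(E i * (t + 1)))) ^ 2 ≤
      (∑ i, w i * Real.exp (-(E i * t))) * (∑ i, w i * Real.exp (-(E i * (t + 2)))) := by
  sorry

/-- EXTRAPOLATION (the lower-pin mechanism): monotone effective mass turns ONE lower bound at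
distance `ℓ` plus the trivial local value `C 0` into a lower bound at every `n ≥ ℓ`,
`C n ≥ C ℓ · (C ℓ / C 0)^{(n-ℓ)/ℓ}`; with `ℓ = ℓ₀(k) ≍ K₀ log(1/a_k)/a_k` and `C ℓ₀ ≥ ℓ₀^{-q}` (the
borderline threshold) the rate `(q log ℓ₀)/ℓ₀ ≍ a_k q / K₀` is PHYSICAL. [folklore] -/
theorem specSum_extrapolate {N : ℕ} (w E : Fin N → ℝ) (hw : ∀ i, 0 ≤ w i) (hE : ∀ i, 0 ≤ E i)
    (ℓ n : ℕ) (hℓ : 0 < ℓ) (hn : ℓ ≤ n)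
    (hpos : 0 < ∑ i, w i * Real.exp (-(E i * (0 : ℕ)))) :
    (∑ i, w i * Real.exp (-(E i * ℓ))) *
        ((∑ i, w i * Real.exp (-(E i * ℓ))) / (∑ i, w i * Real.exp (-(E i * (0 : ℕ))))) ^
          (((n : ℝ) - ℓ) / ℓ)
      ≤ ∑ i, w i * Real.exp (-(E i * n)) := by
  sorry


/-- TWO-ANCHOR EXTRAPOLATION (card `valence-pion-spectral-pins`, the form actually used): for a
log-convex positive sequence (finite-torus spectral sums `∑ c_ij λ_i^{N-t} λ_j^t`, `c_ij ≥ 0`, are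
sums of log-linear terms, hence log-convex) and anchors `n₁ < n₂ ≤ n`,
`C n ≥ C n₂ · (C n₂ / C n₁)^{(n-n₂)/(n₂-n₁)}`: the decay RATE measured between two SHORT
physical distances (asymptotic-freedom window) bounds the decay at all larger distances. [folklore] -/
theorem logConvexSeq_extrapolate (C : ℕ → ℝ) (hpos : ∀ t, 0 < C t)
    (hconv : ∀ t, C (t + 1) ^ 2 ≤ C t * C (t + 2)) (n₁ n₂ n : ℕ) (h₁₂ : n₁ < n₂) (h₂ : n₂ ≤ n) :
    C n₂ * (C n₂ / C n₁) ^ (((n : ℝ) - n₂) / ((n₂ : ℝ) - n₁)) ≤ C n := by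
  sorry

/-- Spare lemma found this session (Weyl log-majorisation; recorded, not load-bearing): the
mass-SPLIT phase-quenched doublet weight is dominated configuration-wise by the TWISTED doublet
weight, `|det (D - μ)| · |det (D + μ)| ≤ det (Dᴴ D + μ²)` for every square complex matrix `D` and
real `μ` (tested numerically on 4000 random and γ₅-Hermitian matrices; proof: `log |λ| ≺_w log σ`
and convexity of `t ↦ log (e^{2t} + μ²)`). [folklore] -/
theorem absDet_split_le_det_twisted {n : ℕ} (D : Matrix (Fin n) (Fin n) ℂ) (μ : ℝ) :
    ‖(D - (μ : ℂ) • (1 : Matrix (Fin n) (Fin n) ℂ)).det‖ *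
        ‖(D + (μ : ℂ) • (1 : Matrix (Fin n) (Fin n) ℂ)).det‖ ≤
      ‖(D.conjTranspose * D + ((μ : ℂ) ^ 2) • (1 : Matrix (Fin n) (Fin n) ℂ)).det‖ := by
  sorry

end Summit.QuantumFields.QCD.Cruxes.MobilityGap.Sketch
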